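import Literature.MathematicalPhysics.QuantumFieldTheory.ConstructiveQFTWave0Proofs
import HarnessLib

/-!
# Field-dependent block translations preserve product Haar measure (gauge-boot, task L3(ε))

HONEST FRAMING (cell `pub-gaugeboot`, page 1 of every file): the venture produces certified bounds
on lattice expectations at stated coupling, gauge group, dimension and torus size; NOT a mass gap,
NOT a continuum limit, NOT a string tension; NOT Yang–Mills-summit-bearing (barriers
`FixedCouplingUltralocality`, `PerturbativeInvisibility`). This module is a measure-theoretic
lemma serving a small POSITIVE structural result about which positivity constraints a
two-dimensional TORUS certificate may use; it discharges nothing else.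

`measurePreserving_blockMul`: on a finite product `ι → G` of copies of a compact group with
product Haar probability measure, multiplying every coordinate `u_e`, `e ∈ T`, on both sides by
measurable functions `l_e(u)`, `r_e(u)` that do not depend on the coordinates in `T` is measure
preserving (integrate the block `T` first — Mathlib's `lmarginal` — and use two-sided invariance
of Haar measure coordinatewise, `WilsonGauge.measurePreserving_mul_mul`). This is the block
version of the tree's single-coordinate `measurePreserving_update_mul_pi`
(`Literature.MathematicalPhysics.QuantumLattice.BalabanRGSpreadTwist`): the standard link-by-link
change of variables of lattice gauge theory (E. Seiler, LNP 159 (1982), Ch. 2), here in the form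
needed for FIELD-DEPENDENT gauge transformations whose parameters are read off links that are not
transformed (`DiagonalRPTorusTwoZigzag.lean`). Proved; no new definitions.
-/

open MeasureTheory Finset Function
open scoped ENNReal

namespace Summit.QuantumFields.GaugeBoot

open Literature.MathematicalPhysics.QuantumFieldTheory

noncomputable section

namespace DiagRPTwo

/-! ## Field-dependent block translations preserve product Haar measure -/

section Skew

variable {ι : Type*} [Fintype ι] [DecidableEq ι] {G : Type*} [Group G] [TopologicalSpace G]
  [IsTopologicalGroup G] [CompactSpace G] [MeasurableSpace G] [BorelSpace G]
  [SecondCountableTopology G]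

/-- **Block skew translations preserve product Haar measure.** On a finite product of copies of
the compact group `G` with product Haar probability measure, the map multiplying every
coordinate `u_e`, `e ∈ T`, on both sides by measurable functions `l_e(u)`, `r_e(u)` that do not
depend on the coordinates in `T` is measure preserving (integrate the block `T` first — Mathlib's
`lmarginal` — and use two-sided invariance of Haar measure on the compact group coordinatewise).
The block version of `Literature.MathematicalPhysics.QuantumLattice.measurePreserving_update_mul_pi`
(Seiler LNP 159 Ch. 2: the link-by-link change of variables of lattice gauge theory). -/
theorem measurePreserving_blockMul (T : Finset ι) (l r : ι → (ι → G) → G)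
    (hl : ∀ e, Measurable (l e)) (hr : ∀ e, Measurable (r e))
    (hlT : ∀ e, DependsOn (l e) (((Tᶜ : Finset ι)) : Set ι))
    (hrT : ∀ e, DependsOn (r e) (((Tᶜ : Finset ι)) : Set ι)) :
    MeasurePreserving (fun (u : ι → G) e => if e ∈ T then l e u * u e * r e u else u e)
      (Measure.pi fun _ : ι => haarProbability G) (Measure.pi fun _ : ι => haarProbability G) := by
  set S : (ι → G) → (ι → G) := fun u e => if e ∈ T then l e u * u e * r e u else u e with hS_def
  have hS : Measurable S := by
    refine measurable_pi_lambda _ fun e => ?_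
    by_cases he : e ∈ T
    · simp only [hS_def, if_pos he]
      exact ((hl e).mul (measurable_pi_apply e)).mul (hr e)
    · simp only [hS_def, if_neg he]
      exact measurable_pi_apply e
  have hoff : ∀ (x : ι → G) (y : ↥T → G) (e : ι), e ∈ ((Tᶜ : Finset ι) : Set ι) →
      updateFinset x T y e = x e := fun x y e he => by
    have he' : e ∉ T := Finset.mem_compl.1 (Finset.mem_coe.1 he)
    simp only [updateFinset, dif_neg he']
  have key : ∀ f : (ι → G) → ℝ≥0∞, Measurable f →
      ∫⁻ u, f (S u) ∂Measure.pi (fun _ : ι => haarProbability G) =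
        ∫⁻ u, f u ∂Measure.pi (fun _ : ι => haarProbability G) := by
    intro f hf
    refine lintegral_eq_of_lmarginal_eq T (hf.comp hS) hf ?_
    funext x
    set m : (↥T → G) → (↥T → G) := fun y t => l t x * y t * r t x with hm_def
    have h1 : ∀ y : ↥T → G, S (updateFinset x T y) = updateFinset x T (m y) := by
      intro y
      funext e
      by_cases he : e ∈ T
      · simp only [hS_def, if_pos he, updateFinset, dif_pos he, hm_def]
        rw [hlT e (fun e' he' => hoff x y e' he'), hrT e (fun e' he' => hoff x y e' he')]
      · simp only [hS_def, if_neg he, updateFinset, dif_neg he]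
    have hmp : MeasurePreserving m (Measure.pi fun _ : ↥T => haarProbability G)
        (Measure.pi fun _ : ↥T => haarProbability G) :=
      measurePreserving_pi (fun _ : ↥T => haarProbability G) (fun _ : ↥T => haarProbability G)
        fun t => WilsonGauge.measurePreserving_mul_mul (l t x) (r t x)
    simp only [lmarginal, h1]
    exact hmp.lintegral_comp (hf.comp measurable_updateFinset)
  refine ⟨hS, Measure.ext fun s hs => ?_⟩
  rw [Measure.map_apply hS hs, ← lintegral_indicator_one (hS hs), ← lintegral_indicator_one hs,
    ← key _ (measurable_one.indicator hs)]
  rfl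

end Skew

end DiagRPTwo

end

end Summit.QuantumFields.GaugeBoot
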